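import Summits.HodgeConjecture.HodgeConjecture.Theorems.HeckePrymWeilWeilTwelvefoldsSqrtMinus7IsotypicHeckePrymPlaneLemmas
import Summits.HodgeConjecture.HodgeConjecture.Theorems.WeilTwelvefoldsSqrtMinus7.Negative.EigenvalueTyping
import Summits.HodgeConjecture.HodgeConjecture.Theorems.WeilTwelvefoldsSqrtMinus7.Negative.SchoenLinesTyping
import Literature.AlgebraicGeometry.HodgeTheory.AbelianVarietyHOneExactness
import HarnessLib

/-!
# The Hecke–Prym of an `F₂₁`-cover: `j^*` on `H¹` is the `μ₃`-coinvariant map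

Helper file for line `isotypic-unimodular-saturation`, stub `stub_heckePrymWeilPlane`
(`--supports stmt-HodgeConjecture-1261`).  Cohomological half of the lever of the line: for the
Hecke–Prym `j : P' = (ker(𝟙 - t_B))⁰ ↪ B` with section `q` (`q ≫ j = 𝟙 + t_B + t_B²`,
`j ≫ q = 3`) and Hecke operator `φ'` (`φ' ≫ j = j ≫ η_B`), every eigenvector `v` of `φ'^*` on
`H¹(P'(ℂ); ℂ)` is the restriction `j^* w` of an eigenvector `w` of `s_B^*` on `H¹(B(ℂ); ℂ)` lying
in ONE isotypic piece `H¹(B)_{ζ₇^a}`: explicitly `w = 7⁻¹ Σ_k ζ₇^{-ak} (s_B^*)ᵏ q^* v`, with `a = 1`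
for the eigenvalue `g₁ = ζ+ζ²+ζ⁴-ζ³-ζ⁵-ζ⁶` of `φ'^*` and `a = 3` for `-g₁`
(`exists_isotypic_preimage_gaussSum`, `…_neg_gaussSum`), and `g₁ = ± i√7` (`gaussSum_eq_or`);
packaged for the stub's two typed eigenvalues `± i√7` as `exists_isotypic_preimage`.  Why the
formula: `j^* (s_B^*)ᵏ q^* = ψ_k^*` with `ψ_k = j ≫ s_Bᵏ ≫ q`, `ψ₀ = 3`, `ψ₂ = ψ₄ = ψ₁`,
`ψ₅ = ψ₆ = ψ₃`, `6ψ₁ = 3φ' - 3`, `6ψ₃ = -3φ' - 3` (`…IsotypicHeckePrymPlaneLemmas`), so on a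
`g`-eigenvector `j^* w = 7⁻¹(3 + β(g-1)/2 - α(g+1)/2) v`, `α = ζ+ζ²+ζ⁴`, `β = ζ³+ζ⁵+ζ⁶`, and
`β(g₁-1) - α(g₁+1) = 8` because `α + β = -1`, `α - β = g₁`, `g₁² = -7`.  Ingredients: additivity
of pull-back on `H¹` (`HodgeTheory.complexBetti_map_add_one` &c., PROVED in the tree) and the
arithmetic of `ζ₇` (`Negative.SchoenLinesTyping.gaussSum7_sq`).  Everything is PROVED; no
definitions; no Chevalley–Weil (no dimension is computed here).  The linear maps `S = s_B^*`,
`jH = j^*`, `qH = q^*`, `F = φ'^*` on `H¹` enter through equations `hS`, `hJ`, `hQ`, `hF`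
(instantiate with `rfl`).
-/

noncomputable section

set_option linter.dupNamespace false

open CategoryTheory
open Literature.AlgebraicGeometry Literature.AlgebraicGeometry.Motives
  Literature.AlgebraicGeometry.HodgeTheory Literature.AlgebraicTopology.SingularHomology

namespace Summit.HodgeConjecture.HodgeConjecture.Theorems.WeilTwelvefoldsSqrtMinus7.IsotypicUnimodularSaturation

section Coinvariants

variable {B P : AbelianVariety ℂ} {sB tB : B ⟶ B} {j : P ⟶ B} {q : B ⟶ P} {φ' : P ⟶ P}
  {S : complexBetti B.X 1 →ₗ[ℂ] complexBetti B.X 1}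
  {jH : complexBetti B.X 1 →ₗ[ℂ] complexBetti P.X 1}
  {qH : complexBetti P.X 1 →ₗ[ℂ] complexBetti B.X 1}
  {F : complexBetti P.X 1 →ₗ[ℂ] complexBetti P.X 1}

/-- An endomorphism identity read on `H¹`: `f = g ⇒ f^* v = g^* v`. [folklore] -/
theorem map_one_congr {f g : P ⟶ P} (hfg : f = g) (v : complexBetti P.X 1) :
    (complexBetti.map f.hom.hom.hom 1).hom v = (complexBetti.map g.hom.hom.hom 1).hom v := by
  rw [hfg]

/-- `(𝟙_P)^* = 1` on `H¹`. [folklore] -/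
theorem map_id_one_apply (v : complexBetti P.X 1) :
    (complexBetti.map (𝟙 P : P ⟶ P).hom.hom.hom 1).hom v = v := by
  change (complexBetti.map (𝟙 P.X) 1).hom v = v
  rw [complexBetti.map_id]
  rfl

/-- `(f ≫ g)^* x = f^* (g^* x)` on `H¹` (functoriality, element form; use with `rw`). [folklore] -/
theorem map_comp_one_apply {A' B' C' : AbelianVariety ℂ} (f : A' ⟶ B') (g : B' ⟶ C')
    (x : complexBetti C'.X 1) :
    (complexBetti.map (f ≫ g).hom.hom.hom 1).hom x =
      (complexBetti.map f.hom.hom.hom 1).hom ((complexBetti.map g.hom.hom.hom 1).hom x) := by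
  rw [complexBetti_map_comp_hom]
  rfl

/-- `(s_B^*)⁷ = 1` on `H¹(B(ℂ); ℂ)` when `Φ₇(s_B) = 0` (`s_B⁷ = 𝟙`, functoriality). [folklore] -/
theorem map_one_pow_seven
    (h : 𝟙 B + sB + sB ≫ sB + sB ≫ sB ≫ sB + sB ≫ sB ≫ sB ≫ sB + sB ≫ sB ≫ sB ≫ sB ≫ sB +
      sB ≫ sB ≫ sB ≫ sB ≫ sB ≫ sB = 0)
    (hS : S = (complexBetti.map sB.hom.hom.hom 1).hom) (x : complexBetti B.X 1) :
    S (S (S (S (S (S (S x)))))) = x := by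
  subst hS
  have h7 := congrArg (fun f : B ⟶ B => (complexBetti.map f.hom.hom.hom 1).hom x)
    (comp_pow_seven_eq_id_of_cyclotomic₇ h)
  dsimp only at h7
  repeat rw [map_comp_one_apply] at h7
  rw [h7]
  exact map_id_one_apply x

/-- `j^* q^* = 3` on `H¹(P'(ℂ); ℂ)` (`j ≫ q = 3`). [folklore] -/
theorem map_incl_map_section [Mono j] (hj : j ≫ tB = j) (hq : q ≫ j = 𝟙 B + tB + tB ≫ tB)
    (hJ : jH = (complexBetti.map j.hom.hom.hom 1).hom) (hQ : qH = (complexBetti.map q.hom.hom.hom 1).hom)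
    (v : complexBetti P.X 1) : jH (qH v) = (3 : ℂ) • v := by
  subst hJ hQ
  exact complexBetti_map_map_one_of_comp_eq_nsmul_id (incl_comp_section hj hq) v

/-- **`ψ₁^* v = ((g-1)/2) v` on a `g`-eigenvector of `φ'^*`** (`ψ₁ = j ≫ s_B ≫ q`; from
`6ψ₁ = 3φ' - 3` and additivity of pull-back on `H¹`). [folklore] -/
theorem map_psi_one_of_eigen [Mono j]
    (h : 𝟙 B + sB + sB ≫ sB + sB ≫ sB ≫ sB + sB ≫ sB ≫ sB ≫ sB + sB ≫ sB ≫ sB ≫ sB ≫ sB +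
      sB ≫ sB ≫ sB ≫ sB ≫ sB ≫ sB = 0)
    (hst : sB ≫ tB = tB ≫ sB ≫ sB) (hj : j ≫ tB = j) (h3 : tB ≫ tB ≫ tB = 𝟙 B)
    (hq : q ≫ j = 𝟙 B + tB + tB ≫ tB)
    (hφ' : φ' ≫ j = j ≫ (sB + sB ≫ sB + sB ≫ sB ≫ sB ≫ sB - sB ≫ sB ≫ sB -
      sB ≫ sB ≫ sB ≫ sB ≫ sB - sB ≫ sB ≫ sB ≫ sB ≫ sB ≫ sB))
    (hS : S = (complexBetti.map sB.hom.hom.hom 1).hom) (hJ : jH = (complexBetti.map j.hom.hom.hom 1).hom)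
    (hQ : qH = (complexBetti.map q.hom.hom.hom 1).hom) (hF : F = (complexBetti.map φ'.hom.hom.hom 1).hom)
    {g : ℂ} {v : complexBetti P.X 1} (hv : F v = g • v) :
    jH (S (qH v)) = ((g - 1) / 2) • v := by
  subst hS hJ hQ hF
  have key := congrArg (fun f : P ⟶ P => (complexBetti.map f.hom.hom.hom 1).hom v)
    (six_smul_psi_one h hst hj h3 hq rfl hφ')
  dsimp only at key
  rw [complexBetti_map_nsmul_one, complexBetti_map_sub_one, complexBetti_map_nsmul_one,
    complexBetti_map_nsmul_one] at key
  simp only [ModuleCat.hom_nsmul, ModuleCat.hom_sub, LinearMap.smul_apply, LinearMap.sub_apply]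
    at key
  repeat rw [map_comp_one_apply] at key
  rw [map_id_one_apply, hv, ← Nat.cast_smul_eq_nsmul ℂ, ← Nat.cast_smul_eq_nsmul ℂ,
    ← Nat.cast_smul_eq_nsmul ℂ] at key
  push_cast at key
  -- key : (6 : ℂ) • x = (3 : ℂ) • g • v - (3 : ℂ) • v
  have e : ∀ x : complexBetti P.X 1, x = (6 : ℂ)⁻¹ • ((6 : ℂ) • x) := fun x => by
    rw [smul_smul, inv_mul_cancel₀ (by norm_num : (6 : ℂ) ≠ 0), one_smul]
  rw [e ((complexBetti.map j.hom.hom.hom 1).hom _), key]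
  module

/-- **`ψ₃^* v = (-(g+1)/2) v` on a `g`-eigenvector of `φ'^*`** (`ψ₃ = j ≫ s_B³ ≫ q`; from
`6ψ₃ = -3φ' - 3`). [folklore] -/
theorem map_psi_three_of_eigen [Mono j]
    (h : 𝟙 B + sB + sB ≫ sB + sB ≫ sB ≫ sB + sB ≫ sB ≫ sB ≫ sB + sB ≫ sB ≫ sB ≫ sB ≫ sB +
      sB ≫ sB ≫ sB ≫ sB ≫ sB ≫ sB = 0)
    (hst : sB ≫ tB = tB ≫ sB ≫ sB) (hj : j ≫ tB = j) (h3 : tB ≫ tB ≫ tB = 𝟙 B)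
    (hq : q ≫ j = 𝟙 B + tB + tB ≫ tB)
    (hφ' : φ' ≫ j = j ≫ (sB + sB ≫ sB + sB ≫ sB ≫ sB ≫ sB - sB ≫ sB ≫ sB -
      sB ≫ sB ≫ sB ≫ sB ≫ sB - sB ≫ sB ≫ sB ≫ sB ≫ sB ≫ sB))
    (hS : S = (complexBetti.map sB.hom.hom.hom 1).hom) (hJ : jH = (complexBetti.map j.hom.hom.hom 1).hom)
    (hQ : qH = (complexBetti.map q.hom.hom.hom 1).hom) (hF : F = (complexBetti.map φ'.hom.hom.hom 1).hom)
    {g : ℂ} {v : complexBetti P.X 1} (hv : F v = g • v) :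
    jH (S (S (S (qH v)))) = (-(g + 1) / 2) • v := by
  subst hS hJ hQ hF
  have key := congrArg (fun f : P ⟶ P => (complexBetti.map f.hom.hom.hom 1).hom v)
    (six_smul_psi_three h hst hj h3 hq rfl hφ')
  dsimp only at key
  rw [complexBetti_map_nsmul_one, complexBetti_map_sub_one, complexBetti_map_neg_one,
    complexBetti_map_nsmul_one, complexBetti_map_nsmul_one] at key
  simp only [ModuleCat.hom_nsmul, ModuleCat.hom_sub, ModuleCat.hom_neg, LinearMap.smul_apply,
    LinearMap.sub_apply, LinearMap.neg_apply] at key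
  repeat rw [map_comp_one_apply] at key
  rw [map_id_one_apply, hv, ← Nat.cast_smul_eq_nsmul ℂ, ← Nat.cast_smul_eq_nsmul ℂ,
    ← Nat.cast_smul_eq_nsmul ℂ] at key
  push_cast at key
  have e : ∀ x : complexBetti P.X 1, x = (6 : ℂ)⁻¹ • ((6 : ℂ) • x) := fun x => by
    rw [smul_smul, inv_mul_cancel₀ (by norm_num : (6 : ℂ) ≠ 0), one_smul]
  rw [e ((complexBetti.map j.hom.hom.hom 1).hom _), key]
  module

/-- **`j^*` of a twisted average.**  For a `g`-eigenvector `v` of `φ'^*` and `u = q^* v`: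
`j^*(Σ_k c_k (s_B^*)ᵏ u) = (3c₀ + (c₁+c₂+c₄)(g-1)/2 - (c₃+c₅+c₆)(g+1)/2) v`, by `j^* q^* = 3`,
`ψ_{2k} = ψ_k` and the values of `ψ₁^*`, `ψ₃^*` on `v`. [folklore] -/
theorem map_incl_twistedAverage [Mono j]
    (h : 𝟙 B + sB + sB ≫ sB + sB ≫ sB ≫ sB + sB ≫ sB ≫ sB ≫ sB + sB ≫ sB ≫ sB ≫ sB ≫ sB +
      sB ≫ sB ≫ sB ≫ sB ≫ sB ≫ sB = 0)
    (hst : sB ≫ tB = tB ≫ sB ≫ sB) (hj : j ≫ tB = j) (h3 : tB ≫ tB ≫ tB = 𝟙 B)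
    (hq : q ≫ j = 𝟙 B + tB + tB ≫ tB)
    (hφ' : φ' ≫ j = j ≫ (sB + sB ≫ sB + sB ≫ sB ≫ sB ≫ sB - sB ≫ sB ≫ sB -
      sB ≫ sB ≫ sB ≫ sB ≫ sB - sB ≫ sB ≫ sB ≫ sB ≫ sB ≫ sB))
    (hS : S = (complexBetti.map sB.hom.hom.hom 1).hom) (hJ : jH = (complexBetti.map j.hom.hom.hom 1).hom)
    (hQ : qH = (complexBetti.map q.hom.hom.hom 1).hom) (hF : F = (complexBetti.map φ'.hom.hom.hom 1).hom)
    {g : ℂ} {v : complexBetti P.X 1} (hv : F v = g • v) (c₀ c₁ c₂ c₃ c₄ c₅ c₆ : ℂ) :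
    jH (c₀ • qH v + c₁ • S (qH v) + c₂ • S (S (qH v)) + c₃ • S (S (S (qH v))) +
        c₄ • S (S (S (S (qH v)))) + c₅ • S (S (S (S (S (qH v))))) +
        c₆ • S (S (S (S (S (S (qH v))))))) =
      (c₀ * 3 + (c₁ + c₂ + c₄) * ((g - 1) / 2) + (c₃ + c₅ + c₆) * (-(g + 1) / 2)) • v := by
  have e0 := map_incl_map_section hj hq hJ hQ v
  have e1 := map_psi_one_of_eigen h hst hj h3 hq hφ' hS hJ hQ hF hv
  have e3 := map_psi_three_of_eigen h hst hj h3 hq hφ' hS hJ hQ hF hv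
  subst hS hJ hQ hF
  have e2 := map_one_congr (psi_two hst hj h3 hq (s := sB)) v
  have e4 := map_one_congr (psi_four hst hj h3 hq (s := sB)) v
  have e6 := map_one_congr (psi_six hst hj h3 hq (s := sB)) v
  have e5 := map_one_congr (psi_five h hst hj h3 hq) v
  repeat rw [map_comp_one_apply] at e2
  repeat rw [map_comp_one_apply] at e4
  repeat rw [map_comp_one_apply] at e5
  repeat rw [map_comp_one_apply] at e6
  simp only [map_add, map_smul]
  rw [e2, e4, e5, e6, e0, e1, e3]
  module

/-- **The twisted average `Σ_k c_k (s_B^*)ᵏ u` is a `ζ₇^a`-eigenvector of `s_B^*`** when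
`ζ₇^a c_{k+1} = c_k` (indices mod `7`) and `(s_B^*)⁷ = 1`. [folklore] -/
theorem twistedAverage_mem_eigenspace
    (h : 𝟙 B + sB + sB ≫ sB + sB ≫ sB ≫ sB + sB ≫ sB ≫ sB ≫ sB + sB ≫ sB ≫ sB ≫ sB ≫ sB +
      sB ≫ sB ≫ sB ≫ sB ≫ sB ≫ sB = 0)
    (hS : S = (complexBetti.map sB.hom.hom.hom 1).hom)
    (a : ℕ) (c₀ c₁ c₂ c₃ c₄ c₅ c₆ : ℂ)
    (hc1 : Complex.exp (2 * (Real.pi : ℂ) * Complex.I / 7) ^ a * c₁ = c₀)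
    (hc2 : Complex.exp (2 * (Real.pi : ℂ) * Complex.I / 7) ^ a * c₂ = c₁)
    (hc3 : Complex.exp (2 * (Real.pi : ℂ) * Complex.I / 7) ^ a * c₃ = c₂)
    (hc4 : Complex.exp (2 * (Real.pi : ℂ) * Complex.I / 7) ^ a * c₄ = c₃)
    (hc5 : Complex.exp (2 * (Real.pi : ℂ) * Complex.I / 7) ^ a * c₅ = c₄)
    (hc6 : Complex.exp (2 * (Real.pi : ℂ) * Complex.I / 7) ^ a * c₆ = c₅)
    (hc0 : Complex.exp (2 * (Real.pi : ℂ) * Complex.I / 7) ^ a * c₀ = c₆)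
    (u : complexBetti B.X 1) :
    c₀ • u + c₁ • S u + c₂ • S (S u) + c₃ • S (S (S u)) + c₄ • S (S (S (S u))) +
        c₅ • S (S (S (S (S u)))) + c₆ • S (S (S (S (S (S u))))) ∈
      Module.End.eigenspace S (Complex.exp (2 * (Real.pi : ℂ) * Complex.I / 7) ^ a) := by
  rw [Module.End.mem_eigenspace_iff]
  simp only [map_add, map_smul, map_one_pow_seven h hS, smul_add, smul_smul, hc1, hc2, hc3, hc4,
    hc5, hc6, hc0]
  abel

/-- **Isotypic preimages, parametrised.**  If moreover
`3c₀ + (c₁+c₂+c₄)(g-1)/2 - (c₃+c₅+c₆)(g+1)/2 = 7`, every `g`-eigenvector `v` of `φ'^*` on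
`H¹(P'(ℂ); ℂ)` is `j^* w` for a `ζ₇^a`-eigenvector `w` of `s_B^*` on `H¹(B(ℂ); ℂ)`
(`w = 7⁻¹ Σ_k c_k (s_B^*)ᵏ q^* v`). [folklore] -/
theorem exists_isotypic_preimage_of_coeffs [Mono j]
    (h : 𝟙 B + sB + sB ≫ sB + sB ≫ sB ≫ sB + sB ≫ sB ≫ sB ≫ sB + sB ≫ sB ≫ sB ≫ sB ≫ sB +
      sB ≫ sB ≫ sB ≫ sB ≫ sB ≫ sB = 0)
    (hst : sB ≫ tB = tB ≫ sB ≫ sB) (hj : j ≫ tB = j) (h3 : tB ≫ tB ≫ tB = 𝟙 B)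
    (hq : q ≫ j = 𝟙 B + tB + tB ≫ tB)
    (hφ' : φ' ≫ j = j ≫ (sB + sB ≫ sB + sB ≫ sB ≫ sB ≫ sB - sB ≫ sB ≫ sB -
      sB ≫ sB ≫ sB ≫ sB ≫ sB - sB ≫ sB ≫ sB ≫ sB ≫ sB ≫ sB))
    (hS : S = (complexBetti.map sB.hom.hom.hom 1).hom) (hJ : jH = (complexBetti.map j.hom.hom.hom 1).hom)
    (hQ : qH = (complexBetti.map q.hom.hom.hom 1).hom) (hF : F = (complexBetti.map φ'.hom.hom.hom 1).hom)
    {g : ℂ} (a : ℕ) (c₀ c₁ c₂ c₃ c₄ c₅ c₆ : ℂ)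
    (hc1 : Complex.exp (2 * (Real.pi : ℂ) * Complex.I / 7) ^ a * c₁ = c₀)
    (hc2 : Complex.exp (2 * (Real.pi : ℂ) * Complex.I / 7) ^ a * c₂ = c₁)
    (hc3 : Complex.exp (2 * (Real.pi : ℂ) * Complex.I / 7) ^ a * c₃ = c₂)
    (hc4 : Complex.exp (2 * (Real.pi : ℂ) * Complex.I / 7) ^ a * c₄ = c₃)
    (hc5 : Complex.exp (2 * (Real.pi : ℂ) * Complex.I / 7) ^ a * c₅ = c₄)
    (hc6 : Complex.exp (2 * (Real.pi : ℂ) * Complex.I / 7) ^ a * c₆ = c₅)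
    (hc0 : Complex.exp (2 * (Real.pi : ℂ) * Complex.I / 7) ^ a * c₀ = c₆)
    (hscal : c₀ * 3 + (c₁ + c₂ + c₄) * ((g - 1) / 2) + (c₃ + c₅ + c₆) * (-(g + 1) / 2) = 7)
    (v : complexBetti P.X 1) (hv : v ∈ Module.End.eigenspace F g) :
    ∃ w ∈ Module.End.eigenspace S (Complex.exp (2 * (Real.pi : ℂ) * Complex.I / 7) ^ a), jH w = v := by
  rw [Module.End.mem_eigenspace_iff] at hv
  refine ⟨(7 : ℂ)⁻¹ • (c₀ • qH v + c₁ • S (qH v) + c₂ • S (S (qH v)) + c₃ • S (S (S (qH v))) +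
      c₄ • S (S (S (S (qH v)))) + c₅ • S (S (S (S (S (qH v))))) +
      c₆ • S (S (S (S (S (S (qH v))))))), Submodule.smul_mem _ _
      (twistedAverage_mem_eigenspace h hS a c₀ c₁ c₂ c₃ c₄ c₅ c₆ hc1 hc2 hc3 hc4 hc5 hc6 hc0 _),
    ?_⟩
  rw [map_smul, map_incl_twistedAverage h hst hj h3 hq hφ' hS hJ hQ hF hv, hscal, smul_smul,
    inv_mul_cancel₀ (by norm_num : (7 : ℂ) ≠ 0), one_smul]

/-! ### The arithmetic of `ζ₇`: the instances `(a, g) = (1, g₁)`, `(3, -g₁)`, and `g₁ = ± i√7` -/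

/-- `ζ₇⁷ = 1` (from `Negative.SchoenLinesTyping`). [folklore] -/
theorem zeta7_pow_seven : Complex.exp (2 * (Real.pi : ℂ) * Complex.I / 7) ^ 7 = 1 :=
  Negative.ζ7_pow_seven

/-- `Φ₇(ζ₇) = 0` (from `Negative.SchoenLinesTyping`). [folklore] -/
theorem zeta7_cyclotomic :
    1 + Complex.exp (2 * (Real.pi : ℂ) * Complex.I / 7) + Complex.exp (2 * (Real.pi : ℂ) * Complex.I / 7) ^ 2 +
      Complex.exp (2 * (Real.pi : ℂ) * Complex.I / 7) ^ 3 + Complex.exp (2 * (Real.pi : ℂ) * Complex.I / 7) ^ 4 +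
      Complex.exp (2 * (Real.pi : ℂ) * Complex.I / 7) ^ 5 + Complex.exp (2 * (Real.pi : ℂ) * Complex.I / 7) ^ 6 = 0 :=
  Negative.ζ7_cyclotomic

/-- **Every `g₁`-eigenvector of `φ'^*` comes from the `ζ₇`-isotypic piece of `H¹(B)`**,
`g₁ = ζ+ζ²+ζ⁴-ζ³-ζ⁵-ζ⁶` (coefficients `c_k = ζ₇^{7-k}`; scalar certificate
`β(g₁-1) - α(g₁+1) - 8 = (-ζ⁵-2ζ⁴+ζ³-ζ+6)(ζ⁷-1) - 2Φ₇(ζ)`). [folklore] -/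
theorem exists_isotypic_preimage_gaussSum [Mono j]
    (h : 𝟙 B + sB + sB ≫ sB + sB ≫ sB ≫ sB + sB ≫ sB ≫ sB ≫ sB + sB ≫ sB ≫ sB ≫ sB ≫ sB +
      sB ≫ sB ≫ sB ≫ sB ≫ sB ≫ sB = 0)
    (hst : sB ≫ tB = tB ≫ sB ≫ sB) (hj : j ≫ tB = j) (h3 : tB ≫ tB ≫ tB = 𝟙 B)
    (hq : q ≫ j = 𝟙 B + tB + tB ≫ tB)
    (hφ' : φ' ≫ j = j ≫ (sB + sB ≫ sB + sB ≫ sB ≫ sB ≫ sB - sB ≫ sB ≫ sB -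
      sB ≫ sB ≫ sB ≫ sB ≫ sB - sB ≫ sB ≫ sB ≫ sB ≫ sB ≫ sB))
    (hS : S = (complexBetti.map sB.hom.hom.hom 1).hom) (hJ : jH = (complexBetti.map j.hom.hom.hom 1).hom)
    (hF : F = (complexBetti.map φ'.hom.hom.hom 1).hom)
    (v : complexBetti P.X 1)
    (hv : v ∈ Module.End.eigenspace F
      (Complex.exp (2 * (Real.pi : ℂ) * Complex.I / 7) + Complex.exp (2 * (Real.pi : ℂ) * Complex.I / 7) ^ 2 +
        Complex.exp (2 * (Real.pi : ℂ) * Complex.I / 7) ^ 4 - Complex.exp (2 * (Real.pi : ℂ) * Complex.I / 7) ^ 3 -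
        Complex.exp (2 * (Real.pi : ℂ) * Complex.I / 7) ^ 5 - Complex.exp (2 * (Real.pi : ℂ) * Complex.I / 7) ^ 6)) :
    ∃ w ∈ Module.End.eigenspace S (Complex.exp (2 * (Real.pi : ℂ) * Complex.I / 7) ^ 1), jH w = v := by
  have h7 := zeta7_pow_seven
  have hΦ := zeta7_cyclotomic
  refine exists_isotypic_preimage_of_coeffs h hst hj h3 hq hφ' hS hJ rfl hF 1
    1 (Complex.exp (2 * (Real.pi : ℂ) * Complex.I / 7) ^ 6) (Complex.exp (2 * (Real.pi : ℂ) * Complex.I / 7) ^ 5)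
    (Complex.exp (2 * (Real.pi : ℂ) * Complex.I / 7) ^ 4) (Complex.exp (2 * (Real.pi : ℂ) * Complex.I / 7) ^ 3)
    (Complex.exp (2 * (Real.pi : ℂ) * Complex.I / 7) ^ 2) (Complex.exp (2 * (Real.pi : ℂ) * Complex.I / 7))
    (by linear_combination h7) (by ring) (by ring) (by ring) (by ring) (by ring) (by ring) ?_ v hv
  linear_combination ((1 : ℂ) / 2 * (-Complex.exp (2 * (Real.pi : ℂ) * Complex.I / 7) ^ 5 -
      2 * Complex.exp (2 * (Real.pi : ℂ) * Complex.I / 7) ^ 4 + Complex.exp (2 * (Real.pi : ℂ) * Complex.I / 7) ^ 3 -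
      Complex.exp (2 * (Real.pi : ℂ) * Complex.I / 7) + 6)) * h7 + (-(1 : ℂ)) * hΦ

/-- **Every `(-g₁)`-eigenvector of `φ'^*` comes from the `ζ₇³`-isotypic piece of `H¹(B)`**
(coefficients `c_k = ζ₇^{-3k}`; the same scalar certificate). [folklore] -/
theorem exists_isotypic_preimage_neg_gaussSum [Mono j]
    (h : 𝟙 B + sB + sB ≫ sB + sB ≫ sB ≫ sB + sB ≫ sB ≫ sB ≫ sB + sB ≫ sB ≫ sB ≫ sB ≫ sB +
      sB ≫ sB ≫ sB ≫ sB ≫ sB ≫ sB = 0)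
    (hst : sB ≫ tB = tB ≫ sB ≫ sB) (hj : j ≫ tB = j) (h3 : tB ≫ tB ≫ tB = 𝟙 B)
    (hq : q ≫ j = 𝟙 B + tB + tB ≫ tB)
    (hφ' : φ' ≫ j = j ≫ (sB + sB ≫ sB + sB ≫ sB ≫ sB ≫ sB - sB ≫ sB ≫ sB -
      sB ≫ sB ≫ sB ≫ sB ≫ sB - sB ≫ sB ≫ sB ≫ sB ≫ sB ≫ sB))
    (hS : S = (complexBetti.map sB.hom.hom.hom 1).hom) (hJ : jH = (complexBetti.map j.hom.hom.hom 1).hom)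
    (hF : F = (complexBetti.map φ'.hom.hom.hom 1).hom)
    (v : complexBetti P.X 1)
    (hv : v ∈ Module.End.eigenspace F
      (-(Complex.exp (2 * (Real.pi : ℂ) * Complex.I / 7) + Complex.exp (2 * (Real.pi : ℂ) * Complex.I / 7) ^ 2 +
        Complex.exp (2 * (Real.pi : ℂ) * Complex.I / 7) ^ 4 - Complex.exp (2 * (Real.pi : ℂ) * Complex.I / 7) ^ 3 -
        Complex.exp (2 * (Real.pi : ℂ) * Complex.I / 7) ^ 5 - Complex.exp (2 * (Real.pi : ℂ) * Complex.I / 7) ^ 6))) :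
    ∃ w ∈ Module.End.eigenspace S (Complex.exp (2 * (Real.pi : ℂ) * Complex.I / 7) ^ 3), jH w = v := by
  have h7 := zeta7_pow_seven
  have hΦ := zeta7_cyclotomic
  refine exists_isotypic_preimage_of_coeffs h hst hj h3 hq hφ' hS hJ rfl hF 3
    1 (Complex.exp (2 * (Real.pi : ℂ) * Complex.I / 7) ^ 4) (Complex.exp (2 * (Real.pi : ℂ) * Complex.I / 7))
    (Complex.exp (2 * (Real.pi : ℂ) * Complex.I / 7) ^ 5) (Complex.exp (2 * (Real.pi : ℂ) * Complex.I / 7) ^ 2)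
    (Complex.exp (2 * (Real.pi : ℂ) * Complex.I / 7) ^ 6) (Complex.exp (2 * (Real.pi : ℂ) * Complex.I / 7) ^ 3)
    (by linear_combination h7) (by ring) (by linear_combination Complex.exp (2 * (Real.pi : ℂ) * Complex.I / 7) * h7) (by ring)
    (by linear_combination Complex.exp (2 * (Real.pi : ℂ) * Complex.I / 7) ^ 2 * h7) (by ring) (by ring) ?_ v hv
  linear_combination ((1 : ℂ) / 2 * (-Complex.exp (2 * (Real.pi : ℂ) * Complex.I / 7) ^ 5 -
      2 * Complex.exp (2 * (Real.pi : ℂ) * Complex.I / 7) ^ 4 + Complex.exp (2 * (Real.pi : ℂ) * Complex.I / 7) ^ 3 -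
      Complex.exp (2 * (Real.pi : ℂ) * Complex.I / 7) + 6)) * h7 + (-(1 : ℂ)) * hΦ

/-- **The Gauss sum is `± i√7`**: `g₁ = ζ+ζ²+ζ⁴-ζ³-ζ⁵-ζ⁶` satisfies `g₁² = -7 = (i√7)²`
(`Negative.SchoenLinesTyping.gaussSum7_sq`); the sign (classically `+`) is not needed here.
[folklore] -/
theorem gaussSum_eq_or :
    Complex.exp (2 * (Real.pi : ℂ) * Complex.I / 7) + Complex.exp (2 * (Real.pi : ℂ) * Complex.I / 7) ^ 2 +
        Complex.exp (2 * (Real.pi : ℂ) * Complex.I / 7) ^ 4 - Complex.exp (2 * (Real.pi : ℂ) * Complex.I / 7) ^ 3 -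
        Complex.exp (2 * (Real.pi : ℂ) * Complex.I / 7) ^ 5 - Complex.exp (2 * (Real.pi : ℂ) * Complex.I / 7) ^ 6 =
      Complex.I * (Real.sqrt (7 : ℝ) : ℂ) ∨
    Complex.exp (2 * (Real.pi : ℂ) * Complex.I / 7) + Complex.exp (2 * (Real.pi : ℂ) * Complex.I / 7) ^ 2 +
        Complex.exp (2 * (Real.pi : ℂ) * Complex.I / 7) ^ 4 - Complex.exp (2 * (Real.pi : ℂ) * Complex.I / 7) ^ 3 -
        Complex.exp (2 * (Real.pi : ℂ) * Complex.I / 7) ^ 5 - Complex.exp (2 * (Real.pi : ℂ) * Complex.I / 7) ^ 6 =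
      -(Complex.I * (Real.sqrt (7 : ℝ) : ℂ)) := by
  apply sq_eq_sq_iff_eq_or_eq_neg.1
  rw [Negative.gaussSum7_sq, sq, Negative.I_mul_sqrt7_mul_self]
  push_cast
  ring

end Coinvariants

/-- **Isotypic preimages for the stub's typed eigenvalues.**  For the Hecke–Prym datum
(`Φ₇(s_B) = 0`, `s_B t_B = t_B s_B²`, `j ≫ t_B = j`, `t_B³ = 𝟙`, `q ≫ j = 𝟙 + t_B + t_B²`,
`φ' ≫ j = j ≫ η_B`) and `μ = ± i√7` there is an exponent `a ∈ [1, 6]` (`a = 1` or `3`) such that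
every `μ`-eigenvector of `φ'^*` on `H¹(P'(ℂ); ℂ)` is `j^* w` for a `ζ₇^a`-eigenvector `w` of
`s_B^*` on `H¹(B(ℂ); ℂ)` — the `μ₃`-coinvariant description of `j^*` (`H¹(P') = H¹(B)_{t_B}`,
`V_±(P') = j^*(H¹(B)_{ζ^a})`) in the form the pull-back of Schoen's lines consumes. [folklore] -/
theorem exists_isotypic_preimage {B P : AbelianVariety ℂ} {sB tB : B ⟶ B} {j : P ⟶ B} [Mono j]
    {q : B ⟶ P} {φ' : P ⟶ P}
    (h : 𝟙 B + sB + sB ≫ sB + sB ≫ sB ≫ sB + sB ≫ sB ≫ sB ≫ sB + sB ≫ sB ≫ sB ≫ sB ≫ sB +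
      sB ≫ sB ≫ sB ≫ sB ≫ sB ≫ sB = 0)
    (hst : sB ≫ tB = tB ≫ sB ≫ sB) (hj : j ≫ tB = j) (h3 : tB ≫ tB ≫ tB = 𝟙 B)
    (hq : q ≫ j = 𝟙 B + tB + tB ≫ tB)
    (hφ' : φ' ≫ j = j ≫ (sB + sB ≫ sB + sB ≫ sB ≫ sB ≫ sB - sB ≫ sB ≫ sB -
      sB ≫ sB ≫ sB ≫ sB ≫ sB - sB ≫ sB ≫ sB ≫ sB ≫ sB ≫ sB))
    {μ : ℂ}
    (hμ : μ = Complex.I * (Real.sqrt (7 : ℝ) : ℂ) ∨ μ = -(Complex.I * (Real.sqrt (7 : ℝ) : ℂ))) :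
    ∃ a : ℕ, 1 ≤ a ∧ a ≤ 6 ∧ ∀ v : complexBetti P.X 1,
      v ∈ Module.End.eigenspace (complexBetti.map φ'.hom.hom.hom 1).hom μ →
      ∃ w ∈ Module.End.eigenspace (complexBetti.map sB.hom.hom.hom 1).hom
        (Complex.exp (2 * (Real.pi : ℂ) * Complex.I / 7) ^ a), (complexBetti.map j.hom.hom.hom 1).hom w = v := by
  rcases gaussSum_eq_or with hg | hg
  · rcases hμ with rfl | rfl
    · exact ⟨1, le_rfl, by norm_num, fun v hv =>
        exists_isotypic_preimage_gaussSum h hst hj h3 hq hφ' rfl rfl rfl v (by rwa [hg])⟩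
    · exact ⟨3, by norm_num, by norm_num, fun v hv =>
        exists_isotypic_preimage_neg_gaussSum h hst hj h3 hq hφ' rfl rfl rfl v (by rwa [hg])⟩
  · rcases hμ with rfl | rfl
    · exact ⟨3, by norm_num, by norm_num, fun v hv =>
        exists_isotypic_preimage_neg_gaussSum h hst hj h3 hq hφ' rfl rfl rfl v
          (by rwa [hg, neg_neg])⟩
    · exact ⟨1, le_rfl, by norm_num, fun v hv =>
        exists_isotypic_preimage_gaussSum h hst hj h3 hq hφ' rfl rfl rfl v (by rwa [hg])⟩

end Summit.HodgeConjecture.HodgeConjecture.Theorems.WeilTwelvefoldsSqrtMinus7.IsotypicUnimodularSaturation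

end
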